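import Literature.AnabelianGeometry.EtaleTheta.Discharge.Sec1Rmk164ZHatFormHatClass
import Literature.AnabelianGeometry.EtaleTheta.Discharge.Sec1Rmk164CompactThetaYddModelChi
import Literature.AnabelianGeometry.EtaleTheta.Discharge.Sec1Thm110ModelTateNV
import Literature.AnabelianGeometry.EtaleTheta.Discharge.Sec2RigidityAtModelTate
import Literature.AnabelianGeometry.EtaleTheta.SettingModelTateToZHat
import Literature.AnabelianGeometry.EtaleTheta.ThetaSettingHatThetaModels
import HarnessLib

/-!
# [EtTh] Rmk. 1.6.4 (c2) in `Ẑ`-form AT THE TATE DATUM OF RECORD — hypothesis-free, with the exponent COMPUTED: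
# `σ̂·(η̈^Θ)^∧ = (η̈^Θ)^∧ · log(Ü)^(−2ê(σ̂)) · log(q̈)^(−ê(σ̂)²) · log(u)`, `ê(σ̂) :=` the `a`-exponent sum of `σ̂ ∈ F̂₂ ⋊ G_{ℚ_p}`

S. Mochizuki, *The Étale Theta Function …* [EtTh], Publ. RIMS **45** (2009), Remark 1.6.4, PDF p. 26 (PRIMS p. 252): «… a set of
classes `O^×_K̈ · (η̈^Θ)^∧ ∈ H¹(Π_{Ÿ^∧}, Δ_Θ)` on which any `Π_X/Π_{Y^∧} ≅ Ẑ ∋ a` acts via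
`(η̈^Θ)^∧ ↦ (η̈^Θ)^∧ − 2a·log(Ü) − (a²/2)·log(q_X) + log(O^×_K̈)` [cf. Proposition 1.5, (iii)]» [cite: MochizukiEtTh2009, Rmk 1.6.4 p.26].

Layer L2 of the abc-iut cell, seat abc-iut-L2-t12 gen 12, row «(c2)-ZHAT@TATE-DATUM» (OFFER #4; abc-iut-L2-lead gen 9 R1409: «the
model-side NV of (r1) … â = ê(σ̂.left) by 'toZHat_modelχq_apply'»).  PROOF-ONLY (no definition, no instance, no `Prop` fact).
The (r1) `Ẑ`-form is PROVED at our carriers by abc-iut-f-128 (★★ `HatTheta.rmk164_c2_zhat`, p517970) and packaged for the NAMED hat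
classes by abc-iut-f-142 (`HatTheta.rmk164_c2_zhat_hatClass`, p521207; displayed {`Prop15iii`, `Compat`, `hc : IsProfiniteCompletion
ιYdd`}).  THIS FILE evaluates it at the cell's semi-synthetic models, where every displayed input is a THEOREM and the exponent is an
explicit coordinate:
* §1 `rmk164_c2_zhat_hatClass_modelχq` — at the stage-2 model `modelχq p i j` (every `i`, every even `j`), for ANY étale theta datum
  `E` satisfying `Prop15iii` there: `Compat` = abc-iut-L2-d1's `compat_modelχq`, `hc` = abc-iut-f-128's `isProfiniteCompletion_ιYdd_modelχq`
  (NO binder), and **`â = toZHat σ̂ = ê(σ̂.left)`** (this seat's `toZHat_modelχq_apply`, p513751: `ê = SettingModel.eHat`, the completed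
  `a`-exponent sum on the `F̂₂`-coordinate of `Π_X = F̂₂ ⋊ G_{ℚ_p}`) — so the displayed set is {`Prop15iii E`} ALONE;
* §2 **`rmk164_c2_zhat_modelTate`** — at the TATE DATUM OF RECORD `modelχq p 1 2` with the étale theta datum of record
  `etaleThetaDataχqInr p` (`η̈^Θ := etaDdχq`; `Prop15iii` = abc-iut-L2-t6's THEOREM `prop15iii_etaleThetaDataχqInr`): for EVERY
  profinite Θ-quotient record `T` and EVERY `σ̂ ∈ F̂₂ ⋊ G_{ℚ_p}` — **NO displayed hypothesis at all**; and `…_hatThetaModelχq`, the same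
  at abc-iut-f-142's binder-free record `hatThetaModelχq p 1 2`, the normality instance supplied by `deltaThetaHat_normal` (a statement with every argument a closed term of the tree, NO instance argument).

HONEST LABEL: SEMI-SYNTHETIC model (consistency / non-vacuity evidence for OUR typed interfaces, NOT the tempered fundamental group of
a curve); inhabited/computed-at-a-model ≠ proved in print; nothing of [EtTh] Rmk. 1.6.4 is asserted; no side is taken on [IUTchIII]
Cor. 3.12; nothing here asserts that abc is proved or refuted; typed ≠ proved.
-/

noncomputable section

namespace Literature.AnabelianGeometry.EtaleTheta

open scoped IsMulCommutative
open Literature.AnabelianGeometry.SemiGraphs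

namespace ThetaSetting.HatTheta

/-! ### §1. At `modelχq p i j`: `Compat`, `hc` theorems; the exponent is `ê(σ̂.left)` -/

section ModelChiQ

variable {p : ℕ} [Fact p.Prime] {i j : ℤ} {hj : Even j} (T : (ThetaSetting.modelχq p i j hj).HatTheta)

/-- **(c2) in `Ẑ`-form at the stage-2 model `modelχq p i j`, exponent COMPUTED** — for any étale theta datum `E` with `Prop15iii`
(w.r.t. abc-iut-L2-d1's `compat_modelχq`) and `x ∈ O^×_K̈·η̈^Θ`: a Θ-class `x′` with `infl x′ = x` such that for EVERY
`σ̂ ∈ Π_X = F̂₂ ⋊ G_{ℚ_p}` some `u ∈ O^×_K̈` gives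
`σ̂·infl(hatClass x′) = infl(hatClass x′) · infl(hatClass log Ü)^(−2ê) · infl(hatClass kum q̈)^(−ê⋆ê) · infl(hatClass kum u)`,
`ê := eHat σ̂.left ∈ Ẑ` (abc-iut-f-142's `rmk164_c2_zhat_hatClass` with `hc := isProfiniteCompletion_ιYdd_modelχq` and
`toZHat σ̂ = ê(σ̂.left)` by `toZHat_modelχq_apply`).  Displayed: `Prop15iii E` only. [cite: MochizukiEtTh2009, Rmk 1.6.4 p.26] -/
theorem rmk164_c2_zhat_hatClass_modelχq [T.DeltaThetaHat.Normal] (E : (ThetaSetting.modelχq p i j hj).EtaleThetaData)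
    (h15 : Prop15iii E (SettingModel.compat_modelχq p i j hj)) {x : (ThetaSetting.modelχq p i j hj).H1 (ThetaSetting.modelχq p i j hj).GtpYdd}
    (hx : x ∈ E.thetaClasses) :
    haveI := T.ghatThetaYdd_normal (SettingModel.compat_modelχq p i j hj)
    haveI := gtpYddHat_normal (SettingModel.compat_modelχq p i j hj)
    haveI := T.compactSpace_deltaThetaHat
    ∃ x' : (ThetaSetting.modelχq p i j hj).H1Theta
        ((ThetaSetting.modelχq p i j hj).GtpYdd.map (ThetaSetting.modelχq p i j hj).toTheta),
      (ThetaSetting.modelχq p i j hj).inflTheta (ThetaSetting.modelχq p i j hj).GtpYdd x' = x ∧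
      ∀ σh : SettingModel.PiHtχq p i j, ∃ u ∈ (ThetaSetting.modelχq p i j hj).unitsOKdd,
        ContH1.conj T.toThetaHat.toMonoidHom T.DeltaThetaHat σh
            (T.inflThetaHat (T.hatClass T.isProfiniteCompletion_ιYdd_modelχq x')) =
          T.inflThetaHat (T.hatClass T.isProfiniteCompletion_ιYdd_modelχq x')
            * ContH1.zhatPow T.toThetaHat.toMonoidHom T.DeltaThetaHat (ThetaSetting.modelχq p i j hj).GtpYddHat
                (SettingModel.eHat σh.left * SettingModel.eHat σh.left)⁻¹
                (T.inflThetaHat (T.hatClass T.isProfiniteCompletion_ιYdd_modelχq E.logUdd))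
            * ContH1.zhatPow T.toThetaHat.toMonoidHom T.DeltaThetaHat (ThetaSetting.modelχq p i j hj).GtpYddHat
                (ProfiniteZHatPow.powZHat (SettingModel.eHat σh.left) (SettingModel.eHat σh.left))⁻¹
                (T.inflThetaHat (T.hatClass T.isProfiniteCompletion_ιYdd_modelχq
                  (E.kumYdd (E.toKddHat (ThetaSetting.modelχq p i j hj).qddUnit))))
            * T.inflThetaHat (T.hatClass T.isProfiniteCompletion_ιYdd_modelχq (E.kumYdd (E.toKddHat u))) := by
  obtain ⟨x', hx'x, hall⟩ :=
    T.rmk164_c2_zhat_hatClass T.isProfiniteCompletion_ιYdd_modelχq (SettingModel.compat_modelχq p i j hj) E h15 hx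
  refine ⟨x', hx'x, fun σh => ?_⟩
  have h := hall σh
  rw [toZHat_modelχq_apply] at h
  exact h

end ModelChiQ

/-! ### §2. At the Tate datum of record `modelχq p 1 2` with `etaleThetaDataχqInr`: NO displayed hypothesis -/

section ModelTate

variable {p : ℕ} [Fact p.Prime] (T : (ThetaSetting.modelχq p 1 2 even_two).HatTheta)

/-- **(c2) in `Ẑ`-form at THE TATE DATUM OF RECORD, HYPOTHESIS-FREE** — `modelχq p 1 2`, the étale theta datum of record
`etaleThetaDataχqInr p` (`η̈^Θ := etaDdχq`; `Prop15iii` = abc-iut-L2-t6's theorem `prop15iii_etaleThetaDataχqInr`), ANY profinite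
Θ-quotient record `T`: every `x ∈ O^×_K̈·η̈^Θ` has a Θ-class `x′`, `infl x′ = x`, with, for EVERY `σ̂ ∈ F̂₂ ⋊ G_{ℚ_p}` and some
`u ∈ O^×_K̈`, `σ̂·infl(hatClass x′) = infl(hatClass x′) · infl(hatClass log Ü)^(−2ê) · infl(hatClass kum q̈)^(−ê⋆ê) · infl(hatClass kum u)`,
`ê := eHat σ̂.left` — print's «`(η̈^Θ)^∧ ↦ (η̈^Θ)^∧ − 2a·log(Ü) − (a²/2)·log(q_X) + log(O^×_K̈)`, `a ∈ Ẑ`» READ OFF at our Tate datum with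
`a` the `a`-exponent coordinate.  (Non-vacuity of the (r1) shape at OUR model; not a statement about print's curves.)
[cite: MochizukiEtTh2009, Rmk 1.6.4 p.26] -/
theorem rmk164_c2_zhat_modelTate [T.DeltaThetaHat.Normal] {x : (ThetaSetting.modelχq p 1 2 even_two).H1
      (ThetaSetting.modelχq p 1 2 even_two).GtpYdd} (hx : x ∈ (SettingModel.etaleThetaDataχqInr p).thetaClasses) :
    haveI := T.ghatThetaYdd_normal (SettingModel.compat_modelχq p 1 2 even_two)
    haveI := gtpYddHat_normal (SettingModel.compat_modelχq p 1 2 even_two)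
    haveI := T.compactSpace_deltaThetaHat
    ∃ x' : (ThetaSetting.modelχq p 1 2 even_two).H1Theta
        ((ThetaSetting.modelχq p 1 2 even_two).GtpYdd.map (ThetaSetting.modelχq p 1 2 even_two).toTheta),
      (ThetaSetting.modelχq p 1 2 even_two).inflTheta (ThetaSetting.modelχq p 1 2 even_two).GtpYdd x' = x ∧
      ∀ σh : SettingModel.PiHtχq p 1 2, ∃ u ∈ (ThetaSetting.modelχq p 1 2 even_two).unitsOKdd,
        ContH1.conj T.toThetaHat.toMonoidHom T.DeltaThetaHat σh
            (T.inflThetaHat (T.hatClass T.isProfiniteCompletion_ιYdd_modelχq x')) =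
          T.inflThetaHat (T.hatClass T.isProfiniteCompletion_ιYdd_modelχq x')
            * ContH1.zhatPow T.toThetaHat.toMonoidHom T.DeltaThetaHat (ThetaSetting.modelχq p 1 2 even_two).GtpYddHat
                (SettingModel.eHat σh.left * SettingModel.eHat σh.left)⁻¹
                (T.inflThetaHat (T.hatClass T.isProfiniteCompletion_ιYdd_modelχq (SettingModel.etaleThetaDataχqInr p).logUdd))
            * ContH1.zhatPow T.toThetaHat.toMonoidHom T.DeltaThetaHat (ThetaSetting.modelχq p 1 2 even_two).GtpYddHat
                (ProfiniteZHatPow.powZHat (SettingModel.eHat σh.left) (SettingModel.eHat σh.left))⁻¹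
                (T.inflThetaHat (T.hatClass T.isProfiniteCompletion_ιYdd_modelχq
                  ((SettingModel.etaleThetaDataχqInr p).kumYdd ((SettingModel.etaleThetaDataχqInr p).toKddHat
                    (ThetaSetting.modelχq p 1 2 even_two).qddUnit))))
            * T.inflThetaHat (T.hatClass T.isProfiniteCompletion_ιYdd_modelχq
                ((SettingModel.etaleThetaDataχqInr p).kumYdd ((SettingModel.etaleThetaDataχqInr p).toKddHat u))) :=
  T.rmk164_c2_zhat_hatClass_modelχq (SettingModel.etaleThetaDataχqInr p)
    (SettingModel.prop15iii_etaleThetaDataχqInr p (SettingModel.compat_modelχq p 1 2 even_two)) hx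

/-- **The same at abc-iut-f-142's binder-free record `hatThetaModelχq p 1 2`** (profinite Θ-quotient `Π_X ⧸ [[Δ_X,Δ_X],Δ_X]⁻` of the
model's curve datum, p508515): a statement of the tree with EVERY argument a closed term — the classes `O^×_K̈·η̈^Θ` of the Tate datum
and the coordinates of `F̂₂ ⋊ G_{ℚ_p}` only. [cite: MochizukiEtTh2009, Rmk 1.6.4 p.26] -/
theorem rmk164_c2_zhat_hatThetaModelχq
    {x : (ThetaSetting.modelχq p 1 2 even_two).H1 (ThetaSetting.modelχq p 1 2 even_two).GtpYdd}
    (hx : x ∈ (SettingModel.etaleThetaDataχqInr p).thetaClasses) :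
    haveI := (hatThetaModelχq p 1 2 even_two).deltaThetaHat_normal
    haveI := (hatThetaModelχq p 1 2 even_two).ghatThetaYdd_normal (SettingModel.compat_modelχq p 1 2 even_two)
    haveI := gtpYddHat_normal (SettingModel.compat_modelχq p 1 2 even_two)
    haveI := (hatThetaModelχq p 1 2 even_two).compactSpace_deltaThetaHat
    ∃ x' : (ThetaSetting.modelχq p 1 2 even_two).H1Theta
        ((ThetaSetting.modelχq p 1 2 even_two).GtpYdd.map (ThetaSetting.modelχq p 1 2 even_two).toTheta),
      (ThetaSetting.modelχq p 1 2 even_two).inflTheta (ThetaSetting.modelχq p 1 2 even_two).GtpYdd x' = x ∧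
      ∀ σh : SettingModel.PiHtχq p 1 2, ∃ u ∈ (ThetaSetting.modelχq p 1 2 even_two).unitsOKdd,
        ContH1.conj (hatThetaModelχq p 1 2 even_two).toThetaHat.toMonoidHom (hatThetaModelχq p 1 2 even_two).DeltaThetaHat σh
            ((hatThetaModelχq p 1 2 even_two).inflThetaHat ((hatThetaModelχq p 1 2 even_two).hatClass
              (hatThetaModelχq p 1 2 even_two).isProfiniteCompletion_ιYdd_modelχq x')) =
          (hatThetaModelχq p 1 2 even_two).inflThetaHat ((hatThetaModelχq p 1 2 even_two).hatClass
              (hatThetaModelχq p 1 2 even_two).isProfiniteCompletion_ιYdd_modelχq x')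
            * ContH1.zhatPow (hatThetaModelχq p 1 2 even_two).toThetaHat.toMonoidHom
                (hatThetaModelχq p 1 2 even_two).DeltaThetaHat (ThetaSetting.modelχq p 1 2 even_two).GtpYddHat
                (SettingModel.eHat σh.left * SettingModel.eHat σh.left)⁻¹
                ((hatThetaModelχq p 1 2 even_two).inflThetaHat ((hatThetaModelχq p 1 2 even_two).hatClass
                  (hatThetaModelχq p 1 2 even_two).isProfiniteCompletion_ιYdd_modelχq (SettingModel.etaleThetaDataχqInr p).logUdd))
            * ContH1.zhatPow (hatThetaModelχq p 1 2 even_two).toThetaHat.toMonoidHom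
                (hatThetaModelχq p 1 2 even_two).DeltaThetaHat (ThetaSetting.modelχq p 1 2 even_two).GtpYddHat
                (ProfiniteZHatPow.powZHat (SettingModel.eHat σh.left) (SettingModel.eHat σh.left))⁻¹
                ((hatThetaModelχq p 1 2 even_two).inflThetaHat ((hatThetaModelχq p 1 2 even_two).hatClass
                  (hatThetaModelχq p 1 2 even_two).isProfiniteCompletion_ιYdd_modelχq
                  ((SettingModel.etaleThetaDataχqInr p).kumYdd ((SettingModel.etaleThetaDataχqInr p).toKddHat
                    (ThetaSetting.modelχq p 1 2 even_two).qddUnit))))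
            * (hatThetaModelχq p 1 2 even_two).inflThetaHat ((hatThetaModelχq p 1 2 even_two).hatClass
                (hatThetaModelχq p 1 2 even_two).isProfiniteCompletion_ιYdd_modelχq
                ((SettingModel.etaleThetaDataχqInr p).kumYdd ((SettingModel.etaleThetaDataχqInr p).toKddHat u))) :=
  haveI := (hatThetaModelχq p 1 2 even_two).deltaThetaHat_normal
  (hatThetaModelχq p 1 2 even_two).rmk164_c2_zhat_modelTate hx

end ModelTate

end ThetaSetting.HatTheta

end Literature.AnabelianGeometry.EtaleTheta

end
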